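import Summits.CriticalPhenomena.CardyFormulaZ2.Theorems.CardyFlipRussoQuadrupoleSelectionRuleBulkLayer
import Summits.CriticalPhenomena.CardyFormulaZ2.Theorems.CardyFlipRussoQuadrupoleSelectionRuleMonotone
import Summits.CriticalPhenomena.CardyFormulaZ2.Theorems.CardyFlipRussoQuadrupoleSelectionRuleEndpoint

/-!
# The bits leg L5, end to end: kernel + arm estimates ⟹ (Cardy at the fair-diagonal midpoint ⟹ Cardy for `G_s`)

Helper file for the informal kernel crux `QuadrupoleSelectionRule` (stmt-CriticalPhenomena-7029) of
route `CardyFlipRusso` (sub-problem `CardyFormulaZ2`), line `Sketch`, generation 4 (lead c2, cycle 2).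
The composition of everything generation 4 landed on the bits leg (namespace `…Theorems.BitsLeg`):

* `PairRate 1` (the selection rule proper on L5) and `BulkArm ε`, `LayerArm` (the two halves of the
  arm budget) give `ArmBudget 1` (`armBudget_one_of_bulkArm_layerArm`), the kernel in consumed form
  (`bits_of_pairRate_armBudget`), and uniform closeness of `legProb R · δ` on the whole leg
  (`legProb_uniform_close_of_bits`);
* the endpoint `t = 1` IS the route's target object: `legProb R 1 δ = siteCrossingProb R δ`
  (`legProb_one_eq_siteCrossingProb`; `Gamma univ = Gs`).

Hence `gsCardy_of_pairRate_bulkArm_layerArm`: under the three named statements, a crossing limit of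
the annealed fair-diagonal model (`t = ½`: the rotated square grid with one independent fair
Delaunay diagonal per face, fair colours — the endpoint of the route's leg L4) is inherited by site
percolation at `1/2` on the centred square lattice `G_s` (the second conjunct of the route's
`Target`, the conclusion of `SquareFromVoronoiHub`), for EVERY limit function and every conformal
rectangle.  This is leg L5 of the planner's intended proof of `SquareFromVoronoiHub`, formal modulo
`PairRate 1 ∧ BulkArm ε ∧ LayerArm`.
-/

noncomputable section

open MeasureTheory Filter Topology Set
open scoped BigOperators

namespace Summit.CriticalPhenomena.CardyFormulaZ2.Theorems.BitsLeg

open Literature.Probability.LatticeModels Literature.Probability.Percolation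
  Literature.Probability.RandomPlanarGeometry
open Summit.CriticalPhenomena.CardyFormulaZ2.Cruxes.SquareFromVoronoiHub.VoronoiBlocks (siteCrossingProb)
-- buildfix lane 2026-08-20: namespace-local alias(es) so that short names made ambiguous by the
-- 2026-08-15 Literature migration (old home vs re-exported new home, both in the import cone) resolve,
-- as in the accepted build, to `Literature.Probability.RandomPlanarGeometry` (the constant route `CardyFlipRusso` uses). No declaration text changes.
export Literature.Probability.RandomPlanarGeometry (cardyFunction)

/-- **Transfer of a crossing limit along the leg.**  If the annealed crossing probabilities are
uniformly close along the leg for small mesh, a crossing limit at one leg parameter `t ∈ [0,1]` is a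
crossing limit at any other `t' ∈ [0,1]`, for every limit function `F`. -/
theorem hasCrossingLimit_legProb_of_uniform_close (R : ConformalRectangle)
    (hclose : ∀ ε : ℝ, 0 < ε → ∃ δ₀ : ℝ, 0 < δ₀ ∧ ∀ δ : ℝ, 0 < δ → δ < δ₀ →
      ∀ t ∈ Icc (0 : ℝ) 1, ∀ t' ∈ Icc (0 : ℝ) 1, |legProb R t δ - legProb R t' δ| ≤ ε)
    {t t' : ℝ} (ht : t ∈ Icc (0 : ℝ) 1) (ht' : t' ∈ Icc (0 : ℝ) 1) (F : ℝ → ℝ)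
    (h : R.HasCrossingLimit (fun δ => legProb R t δ) F) :
    R.HasCrossingLimit (fun δ => legProb R t' δ) F := by
  intro φ x hx
  have hlim := h φ x hx
  refine hlim.congr_dist ?_
  rw [Metric.tendsto_nhdsWithin_nhds]
  intro ε hε
  obtain ⟨δ₀, hδ₀, hb⟩ := hclose (ε / 2) (half_pos hε)
  refine ⟨δ₀, hδ₀, fun δ hδ hdist => ?_⟩
  have hδpos : 0 < δ := hδ
  have hδlt : δ < δ₀ := by
    have : |δ - 0| < δ₀ := by simpa [Real.dist_eq] using hdist
    rw [sub_zero, abs_of_pos hδpos] at this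
    exact this
  have hle := hb δ hδpos hδlt t ht t' ht'
  rw [Real.dist_eq, sub_zero, Real.dist_eq, abs_abs]
  linarith

/-- **The bits leg, end to end.**  `PairRate 1`, `BulkArm ε` (`ε > 0`) and `LayerArm` transfer
every crossing limit of the annealed fair-diagonal model (`legProb R ½ ·`) to site percolation at
`1/2` on the centred square lattice `G_s` (`siteCrossingProb R ·`, the route's `Target (ii)` /
conclusion of `SquareFromVoronoiHub`); stated for Cardy's function. -/
theorem gsCardy_of_pairRate_bulkArm_layerArm :
    ∀ ε : ℝ, 0 < ε → Summit.CriticalPhenomena.CardyFormulaZ2.Theorems.BitsLeg.PairRate 1 →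
      Summit.CriticalPhenomena.CardyFormulaZ2.Theorems.BitsLeg.BulkArm ε →
        Summit.CriticalPhenomena.CardyFormulaZ2.Theorems.BitsLeg.LayerArm →
          ∀ R : Literature.Probability.RandomPlanarGeometry.ConformalRectangle,
            R.HasCrossingLimit
                (fun δ : ℝ => Summit.CriticalPhenomena.CardyFormulaZ2.Theorems.BitsLeg.legProb R (1 / 2) δ)
                Literature.Probability.RandomPlanarGeometry.cardyFunction →
              R.HasCrossingLimit
                (Summit.CriticalPhenomena.CardyFormulaZ2.Cruxes.SquareFromVoronoiHub.VoronoiBlocks.siteCrossingProb R)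
                Literature.Probability.RandomPlanarGeometry.cardyFunction := by
  intro ε hε hP hB hL R hhalf
  -- the kernel in consumed form and uniform closeness along the whole leg
  have hA : ArmBudget 1 := armBudget_one_of_bulkArm_layerArm ε hε hB hL
  have hbits : QuadrupoleSelectionRuleBits := bits_of_pairRate_armBudget 1 hP hA
  have hclose := legProb_uniform_close_of_bits hbits R
  -- transfer the limit from t = 1/2 to t = 1
  have hone : R.HasCrossingLimit (fun δ => legProb R 1 δ) cardyFunction :=
    hasCrossingLimit_legProb_of_uniform_close R hclose
      ⟨by norm_num, by norm_num⟩ ⟨zero_le_one, le_rfl⟩ cardyFunction hhalf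
  -- the endpoint t = 1 is site percolation on G_s
  intro φ x hx
  have hlim := hone φ x hx
  refine hlim.congr' ?_
  filter_upwards [self_mem_nhdsWithin] with δ hδ
  exact legProb_one_eq_siteCrossingProb R δ hδ

end Summit.CriticalPhenomena.CardyFormulaZ2.Theorems.BitsLeg

end
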